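/-
Copyright (c) 2026. All rights reserved.
Released under Apache 2.0 license as described in the file LICENSE.
Authors: abc-iut cell — seat abc-iut-w4-d104 (gen 4): [AbsTopIII] Cor 2.9 — two chart packages (functions in
`e_x`, input additive structure in `ψ_x`) under the LOCAL linearisation law (merge of p444274 and p445663).
-/
import Literature.AnabelianGeometry.AbsoluteAnabelian.ArchimedeanReconstructionCor29AdditiveInputLocal
import Literature.AnabelianGeometry.AbsoluteAnabelian.ArchimedeanReconstructionCor29Rechart
import HarnessLib

/-!
# [AbsTopIII] Cor 2.9 with two chart packages under the LOCAL linearisation law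

S. Mochizuki, *Topics in absolute anabelian geometry III* (bib key `MochizukiAbsTopIII2015`), Cor 2.9 (a)
p.64 l.44 – p.65 l.2, Prop 2.5 (e) p.57.  PROOF-ONLY file (no definitions): the conjunction of the two
sharpenings of part (A) of row «COR29-L-A-ENGAGE» — p444274 (the input `+ₓ`, `(1/n)·ₓ` linear in a chart
`ψ_x` OF THEIR OWN, bi-differentiable transition to the function chart `e_x`) and p445663 (linearity required
only where the chart sum stays in the chart ball, as a GENUINE `E^top` group law satisfies it near `(p, p)`,
abc-iut-w6-d024 p443220/p444357):

* `NFCurveData.globalArchimedeanCompatibility'_of_two_chartPackages_local` — abc-iut-L4-t4's successor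
  statement of record for the genuine datum, ANY `L`: NF-rational functions holomorphic in the function
  package `(W¹, e, e′, G)` with a uniformiser; input additive structures linear in the second package
  `(W², ψ, ψ′, r²)` UNDER THE LOCAL LAW; transitions ℂ-differentiable at the base points.

This is the weakest (A)-hypothesis of the lineage's files; everything else as p444274.  HONEST SCOPE as
there (chart packages = named analytic structure of `X_v(k_v)`); refereed pre-IUT material; nothing here
bears on the disputed [IUTchIII] Cor. 3.12; typed ≠ endorsed.
-/

noncomputable section

namespace Literature.AnabelianGeometry.AbsoluteAnabelian

namespace ArchimedeanReconstruction

open _root_.Set _root_.Topology _root_.Filter _root_.Metric _root_.Function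
open Cor29 Cor29ChartPackage

open Classical in
/-- **[AbsTopIII] Cor 2.9, successor statement of record, GENUINE datum, ANY `L`, two chart packages, LOCAL
linearisation law**: functions in `e_x` (package `W¹, e, e′` with chart expressions `G` and a uniformiser),
input `+ₓ` linear in `ψ_x` (package `W², ψ, ψ′, r²`) wherever the `ψ`-chart sum stays in the `ψ`-ball, input
`(1/n)·ₓ` = `ψ`-chart division on `W²`, transitions `e_x ∘ ψ_x⁻¹`, `ψ_x ∘ e_x⁻¹` ℂ-differentiable at the base
points. [cite: MochizukiAbsTopIII2015, Corollary 2.9 pp.64–65] -/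
theorem NFCurveData.globalArchimedeanCompatibility'_of_two_chartPackages_local (D : NFCurveData)
    (L : LocalLinearHolStructure D.Xtop) (isNFPoint : D.Xtop → Prop)
    (W₁ : D.Xtop → Set D.Xtop) (e : D.Xtop → D.Xtop → ℂ) (e' : D.Xtop → ℂ → D.Xtop)
    (hW₁ : ∀ x, isNFPoint x → IsOpen (W₁ x) ∧ x ∈ W₁ x)
    (hl₁ : ∀ x, isNFPoint x → ∀ v ∈ W₁ x, e' x (e x v) = v)
    (fval : D.Fn → D.Xtop → D.kv) (vanishesAt : D.Fn → D.Xtop → Prop) (G : D.Xtop → D.Fn → ℂ → ℂ)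
    (κ : ℂ ≃+* D.kv) (hκ : Continuous κ) (hκ' : Continuous κ.symm)
    (hG : ∀ x, isNFPoint x → ∀ f, vanishesAt f x → DifferentiableAt ℂ (G x f) (e x x) ∧
      (∀ᶠ u in 𝓝 x, κ.symm (fval f u) = G x f (e x u)) ∧ fval f x = 0)
    (hvan : ∀ f x, vanishesAt f x → fval f x = 0)
    (hspan : ∀ x, isNFPoint x → ∃ f, vanishesAt f x ∧ deriv (G x f) (e x x) ≠ 0)
    (W₂ : D.Xtop → Set D.Xtop) (ψ : D.Xtop → D.Xtop → ℂ) (ψ' : D.Xtop → ℂ → D.Xtop) (r₂ : D.Xtop → ℝ)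
    (hr₂ : ∀ x, isNFPoint x → 0 < r₂ x) (hW₂ : ∀ x, isNFPoint x → IsOpen (W₂ x) ∧ x ∈ W₂ x)
    (hψ : ∀ x, isNFPoint x → ContinuousOn (ψ x) (W₂ x) ∧ MapsTo (ψ x) (W₂ x) (ball (ψ x x) (r₂ x)))
    (hψ' : ∀ x, isNFPoint x →
      ContinuousOn (ψ' x) (ball (ψ x x) (r₂ x)) ∧ MapsTo (ψ' x) (ball (ψ x x) (r₂ x)) (W₂ x))
    (hl₂ : ∀ x, isNFPoint x → ∀ v ∈ W₂ x, ψ' x (ψ x v) = v)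
    (hrt₂ : ∀ x, isNFPoint x → ∀ w ∈ ball (ψ x x) (r₂ x), ψ x (ψ' x w) = w)
    (ladd₀ : D.Xtop → D.Xtop → D.Xtop → D.Xtop) (scale₀ : D.Xtop → ℕ → D.Xtop → D.Xtop)
    (hladd : ∀ x, isNFPoint x → ∀ a ∈ W₂ x, ∀ b ∈ W₂ x, ψ x a + ψ x b - ψ x x ∈ ball (ψ x x) (r₂ x) →
      ladd₀ x a b = ψ' x (ψ x a + ψ x b - ψ x x))
    (hscale : ∀ x, isNFPoint x → ∀ n : ℕ, 0 < n → ∀ v ∈ W₂ x,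
      scale₀ x n v = ψ' x (ψ x x + (ψ x v - ψ x x) / (n : ℂ)))
    (hT : ∀ x, isNFPoint x → DifferentiableAt ℂ (fun z => e x (ψ' x z)) (ψ x x))
    (hS : ∀ x, isNFPoint x → DifferentiableAt ℂ (fun w => ψ x (e' x w)) (e x x)) :
    GlobalArchimedeanCompatibility' D L isNFPoint (fun _ => D.kv)
      (fun x f => κ (deriv (fun z => G x f (e x (ψ' x z))) (ψ x x)))
      vanishesAt ladd₀ (fun x n v => if v ∈ W₂ x ∧ ‖ψ x v - ψ x x‖ < r₂ x / 2 then scale₀ x n v else x) fval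
      (fun x u v => ψ' x (ψ x x + ((((L.isoUnits x).symm u : ℂˣ) : ℂ) * (ψ x v - ψ x x)))) := by
  refine D.globalArchimedeanCompatibility'_of_chartPackage_input_local L isNFPoint W₂ ψ ψ' r₂ hr₂ hW₂ hψ hψ'
    hl₂ hrt₂ ladd₀ scale₀ hladd hscale fval vanishesAt (fun x f z => G x f (e x (ψ' x z))) κ hκ hκ'
    (fun x hx f hf => ?_) hvan (fun x hx => ?_)
  · obtain ⟨hGd, hFG, hf0⟩ := hG x hx f hf
    obtain ⟨hd, hev⟩ := chartExpr_rechart κ (hW₂ x hx).1 (hW₂ x hx).2 (hl₂ x hx) hGd hFG (hT x hx)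
    exact ⟨hd, hev, hf0⟩
  · obtain ⟨f, hf, hd⟩ := hspan x hx
    exact ⟨f, hf, deriv_rechart_ne_zero (hr₂ x hx) (hW₁ x hx).1 (hW₁ x hx).2 (hW₂ x hx).2 (hl₁ x hx)
      (hψ' x hx).1 (hl₂ x hx) (hrt₂ x hx) (hG x hx f hf).1 hd (hT x hx) (hS x hx)⟩

end ArchimedeanReconstruction

end Literature.AnabelianGeometry.AbsoluteAnabelian

end
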